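import Mathlib
import Summits.CriticalPhenomena.CardyFormulaZ2.Theorems.CardyMagicRigidityMagicFormulaTUVNegligible
import Summits.CriticalPhenomena.CardyFormulaZ2.Theorems.CardyMagicRigidityMagicFormulaTExistsLimitCoupling
import Literature.Probability.Percolation.FullPlaneCNL
import Literature.Probability.Percolation.SiteNestingWeightIntegrable
import Literature.Probability.Percolation.NestingWeightMeasurable
import Literature.Probability.Percolation.NestingPhaseEstimates
import HarnessLib

/-!
# Existence of the scaling limit of the site-`𝕋` twisted nesting transform — part 2/2: the stub (crux `MagicFormulaT`, stub E)

Crux `Summit.CriticalPhenomena.CardyFormulaZ2.Theses.CardyMagicRigidity.MagicFormulaT`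
(stmt-CriticalPhenomena-4836), line `Sketch`, skeleton v7 (lead c3): the registered stub `stub_existsLimit`.

Given (CN) Camia–Newman's full-plane CLE₆ limit in its Cauchy form
(`exists_isFullPlaneCNLLaw.cnLawEDist_siteLoopConfig_le`: the laws of the loop configurations at two small
meshes are `d_CN`-close), (A) the a priori bounds of `stub_aprioriBounds` (uniform second moments of the
truncated weights, tightness of the number of relevant loops, window, thin sausages), (B) the deterministic
comparison `stub_closeComparison` of the THRESHOLD-AVERAGED big-loop weights of two `ε`-close ribbon-free
configurations, (R) the ribbon bound of `stub_ribbonRarity`, and the landed UV theorem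
`smallLoops_negligible_site` (v6), the family `δ ↦ Λ^𝕋_δ(f) = truncNestingTransform P (siteLoopConfig δ) f 0`
is Cauchy as `δ → 0⁺`, hence converges (completeness of `ℝ`).

Proof (`stub_existsLimit`).  Fix `κ > 0`, `κ₁ = κ/10`.  UV gives `η₀` with `|Λ_δ − Λ^{η'}_δ| ≤ κ₁` for all
`η' < η₀` and small `δ`; put `η = η₀/2` and average over the `m` thresholds `η_j = η/2 + (j+1)η/(2m) ∈ (η/2, η]`:
`|Λ_δ − Λ̄_δ| ≤ κ₁`.  For two meshes couple the configurations by a measure `Q` on `Ω × Ω` with marginals `P`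
(CN, `exists_coupling_of_cnLawEDist_lt`); then `Λ̄_δ − Λ̄_{δ'} = ∫ (Ā_δ ∘ fst − Ā_{δ'} ∘ snd) dQ`.  On the
complement of a measurable hull `Bad ⊇` {not `ε`-close} ∪ {marginal bad events} the integrand is `≤ κ₁` by (B);
on `Bad`, `|D| ≤ (t/2) D² + 1/(2t)` with `∫ D² ≤ 4B` by (A)(i) and `Q(Bad) ≤ p₀ = κ₁²/(2(4B+1))` by (A)(ii–iv),
(R) and the coupling (outer measure: `Measure.le_map_apply`), whence `∫_Bad |D| ≤ κ₁`.  Total `≤ 4κ₁ < κ`.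
-/

noncomputable section

namespace Summit.CriticalPhenomena.CardyFormulaZ2.Cruxes.MagicFormulaT.LineSketch

open MeasureTheory Filter Set
open scoped Real Topology BigOperators ENNReal
open Literature.Probability.RandomPlanarGeometry Literature.Probability.Percolation
  Literature.Probability.LatticeModels

/-! ## The stub -/
set_option maxHeartbeats 400000 in -- buildfix (bf3-g26): 160k/180k FAIL, 200k PASS at accept time; line-neutral budget line
/-- **Stub E (`stub_existsLimit`, registered, verbatim signature): existence of the scaling limit of the site-`𝕋`
twisted nesting transform for every admissible density**, from Camia–Newman (Cauchy form), the a priori bounds, the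
deterministic comparison, the ribbon bound and UV — see the module docstring for the proof. -/
theorem stub_existsLimit : exists_isFullPlaneCNLLaw →
    ((∀ (f : ℂ → ℝ) (R C : ℝ), Measurable f → (∀ z, |f z| ≤ C) → (∀ z, R < ‖z‖ → f z = 0) → ∫ z, f z = 0 →
      ∀ η : ℝ, 0 < η → ∃ B δ₀ : ℝ, 0 < B ∧ 0 < δ₀ ∧ ∀ δ η' : ℝ, 0 < δ → δ ≤ δ₀ → η ≤ η' →
        Integrable (fun ω ↦ (siteLoopConfig δ ω).truncNestingWeight f η' ^ 2) (triSitePercolation half) ∧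
        ∫ ω, (siteLoopConfig δ ω).truncNestingWeight f η' ^ 2 ∂(triSitePercolation half) ≤ B) ∧
    (∀ (R η κ : ℝ), 0 < η → 0 < κ → ∃ N₀ : ℕ, ∃ δ₀ : ℝ, 0 < δ₀ ∧ ∀ δ : ℝ, 0 < δ → δ ≤ δ₀ →
      (triSitePercolation half) {ω | ¬ ({u ∈ (siteLoopConfig δ ω).loops |
          (u.range ∩ Metric.closedBall (0 : ℂ) R).Nonempty ∧ η ≤ Metric.diam u.range}.Finite ∧
        {u ∈ (siteLoopConfig δ ω).loops |
          (u.range ∩ Metric.closedBall (0 : ℂ) R).Nonempty ∧ η ≤ Metric.diam u.range}.ncard ≤ N₀)} ≤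
        ENNReal.ofReal κ) ∧
    (∀ (R κ : ℝ), 0 < κ → ∃ D δ₀ : ℝ, 0 < D ∧ 0 < δ₀ ∧ ∀ δ : ℝ, 0 < δ → δ ≤ δ₀ →
      (triSitePercolation half) {ω | ∃ u ∈ (siteLoopConfig δ ω).loops,
        (u.range ∩ Metric.closedBall (0 : ℂ) R).Nonempty ∧ ¬ (u.range ⊆ Metric.ball (0 : ℂ) D)} ≤
        ENNReal.ofReal κ) ∧
    (∀ (R η τ κ : ℝ), 0 < η → 0 < τ → 0 < κ → ∃ ε₀ : ℝ, 0 < ε₀ ∧ ∀ ε : ℝ, 0 < ε → ε ≤ ε₀ →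
      ∃ δ₀ : ℝ, 0 < δ₀ ∧ ∀ δ : ℝ, 0 < δ → δ ≤ δ₀ →
        (triSitePercolation half) {ω | ∃ u ∈ (siteLoopConfig δ ω).loops,
          (u.range ∩ Metric.closedBall (0 : ℂ) (R + 1)).Nonempty ∧ η ≤ Metric.diam u.range ∧
          τ < volume.real ({z : ℂ | Metric.infDist z u.range ≤ ε} ∩ Metric.closedBall (0 : ℂ) R)} ≤
          ENNReal.ofReal κ)) →
    (∀ (f : ℂ → ℝ) (R C : ℝ), Measurable f → (∀ z, |f z| ≤ C) → (∀ z, R < ‖z‖ → f z = 0) → ∫ z, f z = 0 →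
      ∀ (c c' : LoopConfig ℂ) (ε η τ : ℝ) (m N₀ : ℕ), 0 < ε → ε ≤ 1 → 0 < η → 8 * m * ε ≤ η → 0 ≤ τ →
      LoopConfig.IsClose ε c c' →
      ({u ∈ c.loops | (u.range ∩ Metric.closedBall (0 : ℂ) (R + 1)).Nonempty ∧
          η / 5 ≤ Metric.diam u.range}.Finite ∧
        {u ∈ c.loops | (u.range ∩ Metric.closedBall (0 : ℂ) (R + 1)).Nonempty ∧
          η / 5 ≤ Metric.diam u.range}.ncard ≤ N₀) →
      ({u ∈ c'.loops | (u.range ∩ Metric.closedBall (0 : ℂ) (R + 1)).Nonempty ∧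
          η / 5 ≤ Metric.diam u.range}.Finite ∧
        {u ∈ c'.loops | (u.range ∩ Metric.closedBall (0 : ℂ) (R + 1)).Nonempty ∧
          η / 5 ≤ Metric.diam u.range}.ncard ≤ N₀) →
      (∀ u ∈ c.loops, (u.range ∩ Metric.closedBall (0 : ℂ) (R + 1)).Nonempty → η / 5 ≤ Metric.diam u.range →
        u.range ⊆ Metric.ball (0 : ℂ) (1 / ε)) →
      (∀ u ∈ c'.loops, (u.range ∩ Metric.closedBall (0 : ℂ) (R + 1)).Nonempty → η / 5 ≤ Metric.diam u.range →
        u.range ⊆ Metric.ball (0 : ℂ) (1 / ε)) →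
      (∀ u ∈ c.loops, ∀ v ∈ c.loops, (u.range ∩ Metric.closedBall (0 : ℂ) (R + 1)).Nonempty →
        (v.range ∩ Metric.closedBall (0 : ℂ) (R + 1)).Nonempty → η / 5 ≤ Metric.diam u.range →
        η / 5 ≤ Metric.diam v.range → u ≠ v → 2 * ε < u.udist v) →
      (∀ u ∈ c'.loops, ∀ v ∈ c'.loops, (u.range ∩ Metric.closedBall (0 : ℂ) (R + 1)).Nonempty →
        (v.range ∩ Metric.closedBall (0 : ℂ) (R + 1)).Nonempty → η / 5 ≤ Metric.diam u.range →
        η / 5 ≤ Metric.diam v.range → u ≠ v → 2 * ε < u.udist v) →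
      (∀ u ∈ c.loops, (u.range ∩ Metric.closedBall (0 : ℂ) (R + 1)).Nonempty → η / 5 ≤ Metric.diam u.range →
        volume.real ({z : ℂ | Metric.infDist z u.range ≤ ε} ∩ Metric.closedBall (0 : ℂ) R) ≤ τ) →
      |(∑ j ∈ Finset.range m, c.truncNestingWeight f (η / 2 + ((j : ℝ) + 1) * η / (2 * m))) / m -
          (∑ j ∈ Finset.range m, c'.truncNestingWeight f (η / 2 + ((j : ℝ) + 1) * η / (2 * m))) / m| ≤
        2 ^ N₀ * N₀ * (4 * C * τ + 8 * π * C * η ^ 2 / m)) →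
    (∀ (R η κ : ℝ), 0 < η → 0 < κ → ∃ ε₀ : ℝ, 0 < ε₀ ∧ ∀ ε : ℝ, 0 < ε → ε ≤ ε₀ →
      ∃ δ₀ : ℝ, 0 < δ₀ ∧ ∀ δ : ℝ, 0 < δ → δ ≤ δ₀ →
        (triSitePercolation half) {ω | ∃ u ∈ (siteLoopConfig δ ω).loops, ∃ v ∈ (siteLoopConfig δ ω).loops,
          u ≠ v ∧ (u.range ∩ Metric.closedBall (0 : ℂ) R).Nonempty ∧ η ≤ Metric.diam u.range ∧
          η ≤ Metric.diam v.range ∧ u.udist v ≤ 2 * ε} ≤ ENNReal.ofReal κ) →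
    ∀ (f : ℂ → ℝ) (R C : ℝ), Measurable f → (∀ z, |f z| ≤ C) → (∀ z, R < ‖z‖ → f z = 0) → ∫ z, f z = 0 →
      ∃ L : ℝ, Tendsto (fun δ : ℝ ↦ truncNestingTransform (triSitePercolation half) (siteLoopConfig δ) f 0)
        (𝓝[>] 0) (𝓝 L) := by
  intro hCN hA hCmp hRib f R C hf hC hR h0
  obtain ⟨hA1, hA2, hA3, hA4⟩ := hA
  set P : Measure (SiteConfig (Site 2)) := triSitePercolation half with hPdef
  apply el_exists_tendsto_of_cauchy
  intro κ hκ
  set κ₁ : ℝ := κ / 10 with hκ₁def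
  have hκ₁ : 0 < κ₁ := by positivity
  have hC0 : 0 ≤ C := nonneg_of_abs_le hC
  have hUV := smallLoops_negligible_site f R C hf hC hR h0 κ₁ hκ₁
  obtain ⟨η₀, hη₀, hUV'⟩ := mem_nhdsGT_iff_exists_Ioo_subset.1 hUV
  rw [mem_Ioi] at hη₀
  set η : ℝ := η₀ / 2 with hηdef
  have hη : 0 < η := by positivity
  obtain ⟨B, δB, hB, hδB, hsq⟩ := hA1 f R C hf hC hR h0 (η / 2) (by positivity)
  set p₀ : ℝ := κ₁ ^ 2 / (2 * (4 * B + 1)) with hp₀def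
  have hp₀ : 0 < p₀ := by positivity
  -- (A)(ii): tightness of the number of relevant loops
  obtain ⟨N₀, δN, hδN, hN⟩ := hA2 (R + 1) (η / 5) (p₀ / 10) (by positivity) (by positivity)
  -- the number of thresholds `m` and the sausage tolerance `τ`
  set K : ℝ := 2 ^ N₀ * N₀ * 8 * π * C * η ^ 2 with hKdef
  have hK0 : 0 ≤ K := by positivity
  set m : ℕ := ⌈2 * K / κ₁⌉₊ + 1 with hmdef
  have hm1 : 1 ≤ m := Nat.le_add_left 1 _
  have hmpos : (0 : ℝ) < m := by exact_mod_cast hm1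
  have hmK : 2 ^ N₀ * N₀ * (8 * π * C * η ^ 2 / m) ≤ κ₁ / 2 := by
    have h1 : 2 * K / κ₁ ≤ m := by
      rw [hmdef]; push_cast
      exact (Nat.le_ceil _).trans (le_add_of_nonneg_right zero_le_one)
    have h2 : 2 * K ≤ κ₁ * m := by
      have := (div_le_iff₀ hκ₁).1 h1
      linarith
    have h3 : 2 ^ N₀ * N₀ * (8 * π * C * η ^ 2 / m) = K / m := by rw [hKdef]; ring
    rw [h3, div_le_iff₀ hmpos]
    linarith
  set τ : ℝ := κ₁ / 2 / (2 ^ N₀ * N₀ * 4 * C + 1) with hτdef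
  have hτ : 0 < τ := by positivity
  have hτK : 2 ^ N₀ * N₀ * (4 * C * τ) ≤ κ₁ / 2 := by
    have hx : 0 ≤ (2 : ℝ) ^ N₀ * N₀ * 4 * C := by positivity
    have h1 : (2 : ℝ) ^ N₀ * N₀ * 4 * C / (2 ^ N₀ * N₀ * 4 * C + 1) ≤ 1 :=
      (div_le_one (by positivity)).2 (by linarith)
    have h2 : (2 : ℝ) ^ N₀ * N₀ * (4 * C * τ) =
        κ₁ / 2 * (2 ^ N₀ * N₀ * 4 * C / (2 ^ N₀ * N₀ * 4 * C + 1)) := by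
      rw [hτdef]; ring
    rw [h2]
    calc κ₁ / 2 * (2 ^ N₀ * N₀ * 4 * C / (2 ^ N₀ * N₀ * 4 * C + 1)) ≤ κ₁ / 2 * 1 := by gcongr
      _ = κ₁ / 2 := mul_one _
  have hcmpBound : 2 ^ N₀ * N₀ * (4 * C * τ + 8 * π * C * η ^ 2 / m) ≤ κ₁ := by
    have : (2 : ℝ) ^ N₀ * N₀ * (4 * C * τ + 8 * π * C * η ^ 2 / m) =
        2 ^ N₀ * N₀ * (4 * C * τ) + 2 ^ N₀ * N₀ * (8 * π * C * η ^ 2 / m) := by ring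
    rw [this]; linarith
  obtain ⟨εS, hεS, hS⟩ := hA4 R (η / 5) τ (p₀ / 10) (by positivity) hτ (by positivity)
  obtain ⟨εR, hεR, hRb⟩ := hRib (R + 1) (η / 5) (p₀ / 10) (by positivity) (by positivity)
  obtain ⟨D, δW, hD, hδW, hW⟩ := hA3 (R + 1) (p₀ / 10) (by positivity)
  -- the closeness scale `ε`
  set ε : ℝ := min (min (min εS εR) (min (1 / D) (η / (8 * m)))) (min 1 (p₀ / 10)) with hεdef
  have hε : 0 < ε := by positivity
  have hεS' : ε ≤ εS := by rw [hεdef]; exact (min_le_left _ _).trans ((min_le_left _ _).trans (min_le_left _ _))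
  have hεR' : ε ≤ εR := by rw [hεdef]; exact (min_le_left _ _).trans ((min_le_left _ _).trans (min_le_right _ _))
  have hεD : ε ≤ 1 / D := by rw [hεdef]; exact (min_le_left _ _).trans ((min_le_right _ _).trans (min_le_left _ _))
  have hεm : ε ≤ η / (8 * m) := by
    rw [hεdef]; exact (min_le_left _ _).trans ((min_le_right _ _).trans (min_le_right _ _))
  have hε1 : ε ≤ 1 := by rw [hεdef]; exact (min_le_right _ _).trans (min_le_left _ _)
  have hεp : ε ≤ p₀ / 10 := by rw [hεdef]; exact (min_le_right _ _).trans (min_le_right _ _)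
  have h8m : 8 * m * ε ≤ η := by
    have := mul_le_mul_of_nonneg_left hεm (by positivity : (0 : ℝ) ≤ 8 * m)
    calc 8 * m * ε ≤ 8 * m * (η / (8 * m)) := this
      _ = η := by field_simp
  obtain ⟨δS, hδS, hS'⟩ := hS ε hε hεS'
  obtain ⟨δR, hδR, hR'⟩ := hRb ε hε hεR'
  -- (CN): couplings at scale `ε/2`
  have hCNev := hCN.cnLawEDist_siteLoopConfig_le (η := ENNReal.ofReal (ε / 2))
    (ENNReal.ofReal_pos.2 (half_pos hε))
  rw [Filter.eventually_prod_iff] at hCNev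
  obtain ⟨pa, hpa, pb, hpb, hprod⟩ := hCNev
  obtain ⟨δa, hδa, ha⟩ := el_exists_Ioo_of_eventually hpa
  obtain ⟨δb, hδb, hb⟩ := el_exists_Ioo_of_eventually hpb
  -- UV at the `m` thresholds
  set thr : ℕ → ℝ := fun j ↦ η / 2 + ((j : ℝ) + 1) * η / (2 * m) with hthrdef
  have hthr : ∀ j ∈ Finset.range m, thr j ∈ Ioo 0 η₀ := by
    intro j hj
    rw [Finset.mem_range] at hj
    have hj' : (j : ℝ) + 1 ≤ m := by exact_mod_cast hj
    constructor
    · simp only [hthrdef]; positivity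
    · simp only [hthrdef]
      have : ((j : ℝ) + 1) * η / (2 * m) ≤ η / 2 := by
        rw [div_le_div_iff₀ (by positivity) (by positivity)]
        nlinarith
      linarith
  have hthr_ge : ∀ j ∈ Finset.range m, η / 2 ≤ thr j := by
    intro j _; simp only [hthrdef]
    have : 0 ≤ ((j : ℝ) + 1) * η / (2 * m) := by positivity
    linarith
  have hUVm : ∀ᶠ δ in 𝓝[>] (0 : ℝ), ∀ j ∈ Finset.range m,
      |truncNestingTransform P (siteLoopConfig δ) f 0 - truncNestingTransform P (siteLoopConfig δ) f (thr j)|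
        ≤ κ₁ :=
    (Filter.eventually_all_finset _).2 fun j hj ↦ hUV' (hthr j hj)
  obtain ⟨δU, hδU, hU⟩ := el_exists_Ioo_of_eventually hUVm
  refine ⟨min (min (min δB δN) (min δS δR)) (min (min δW δU) (min δa δb)), by positivity, ?_⟩
  intro δ δ' hδ hδlt hδ' hδ'lt
  -- unpack the mesh bounds
  have hlt : ∀ {x : ℝ}, x < min (min (min δB δN) (min δS δR)) (min (min δW δU) (min δa δb)) →
      x < δB ∧ x < δN ∧ x < δS ∧ x < δR ∧ x < δW ∧ x < δU ∧ x < δa ∧ x < δb := by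
    intro x hx
    simp only [lt_min_iff] at hx
    exact ⟨hx.1.1.1, hx.1.1.2, hx.1.2.1, hx.1.2.2, hx.2.1.1, hx.2.1.2, hx.2.2.1, hx.2.2.2⟩
  obtain ⟨h1B, h1N, h1S, h1R, h1W, h1U, h1a, _⟩ := hlt hδlt
  obtain ⟨h2B, h2N, _, h2R, h2W, h2U, _, h2b⟩ := hlt hδ'lt
  -- the averaged weights
  set Abar : ℝ → SiteConfig (Site 2) → ℝ := fun d ω ↦
    (∑ j ∈ Finset.range m, (siteLoopConfig d ω).truncNestingWeight f (η / 2 + ((j : ℝ) + 1) * η / (2 * m))) / m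
    with hAbardef
  -- properties of `Abar d` for `d ∈ {δ, δ'}`
  have hAprops : ∀ d : ℝ, 0 < d → d < δB → d < δU →
      Measurable (Abar d) ∧ Integrable (Abar d) P ∧ Integrable (fun ω ↦ Abar d ω ^ 2) P ∧
        ∫ ω, Abar d ω ^ 2 ∂P ≤ B ∧
        |truncNestingTransform P (siteLoopConfig d) f 0 - ∫ ω, Abar d ω ∂P| ≤ κ₁ := by
    intro d hd hdB hdU
    have hmeas : ∀ j, Measurable fun ω ↦ (siteLoopConfig d ω).truncNestingWeight f (thr j) := fun j ↦
      measurable_truncNestingWeight_siteLoopConfig f _ d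
    have hint : ∀ j, Integrable (fun ω ↦ (siteLoopConfig d ω).truncNestingWeight f (thr j)) P := fun j ↦
      integrable_truncNestingWeight_siteLoopConfig hR h0 hd _ P
    have hsqj : ∀ j ∈ Finset.range m,
        Integrable (fun ω ↦ (siteLoopConfig d ω).truncNestingWeight f (thr j) ^ 2) P ∧
          ∫ ω, (siteLoopConfig d ω).truncNestingWeight f (thr j) ^ 2 ∂P ≤ B := fun j hj ↦
      hsq d (thr j) hd hdB.le (hthr_ge j hj)
    have hM : Measurable (Abar d) := by
      simp only [hAbardef]
      exact (Finset.measurable_sum _ fun j _ ↦ hmeas j).div_const _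
    have hI : Integrable (Abar d) P := by
      simp only [hAbardef]
      exact (integrable_finsetSum _ fun j _ ↦ hint j).div_const _
    have hdom : ∀ ω, Abar d ω ^ 2 ≤
        (∑ j ∈ Finset.range m, (siteLoopConfig d ω).truncNestingWeight f (thr j) ^ 2) / m := fun ω ↦
      el_sq_avg_le (m := m) fun j ↦ (siteLoopConfig d ω).truncNestingWeight f (thr j)
    have hIsum : Integrable (fun ω ↦
        (∑ j ∈ Finset.range m, (siteLoopConfig d ω).truncNestingWeight f (thr j) ^ 2) / m) P :=
      (integrable_finsetSum _ fun j hj ↦ (hsqj j hj).1).div_const _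
    have hI2 : Integrable (fun ω ↦ Abar d ω ^ 2) P := by
      refine hIsum.mono' (hM.pow_const 2).aestronglyMeasurable (Eventually.of_forall fun ω ↦ ?_)
      rw [Real.norm_eq_abs, abs_of_nonneg (sq_nonneg _)]
      exact hdom ω
    have hEB : ∫ ω, Abar d ω ^ 2 ∂P ≤ B := by
      calc ∫ ω, Abar d ω ^ 2 ∂P
          ≤ ∫ ω, (∑ j ∈ Finset.range m, (siteLoopConfig d ω).truncNestingWeight f (thr j) ^ 2) / m ∂P :=
            integral_mono hI2 hIsum hdom
        _ = (∑ j ∈ Finset.range m, ∫ ω, (siteLoopConfig d ω).truncNestingWeight f (thr j) ^ 2 ∂P) / m := by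
            rw [integral_div, integral_finsetSum _ fun j hj ↦ (hsqj j hj).1]
        _ ≤ (∑ _j ∈ Finset.range m, B) / m := by
            gcongr with j hj
            exact (hsqj j hj).2
        _ = B := by rw [Finset.sum_const, Finset.card_range, nsmul_eq_mul]; field_simp
    have hEavg : ∫ ω, Abar d ω ∂P =
        (∑ j ∈ Finset.range m, truncNestingTransform P (siteLoopConfig d) f (thr j)) / m := by
      simp only [hAbardef, truncNestingTransform]
      rw [integral_div, integral_finsetSum _ fun j _ ↦ hint j]
    have hUVd : |truncNestingTransform P (siteLoopConfig d) f 0 - ∫ ω, Abar d ω ∂P| ≤ κ₁ := by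
      rw [hEavg]
      exact el_abs_sub_avg_le hm1 (a := fun j ↦ truncNestingTransform P (siteLoopConfig d) f (thr j))
        (hU d hd hdU)
    exact ⟨hM, hI, hI2, hEB, hUVd⟩
  obtain ⟨hM1, hI1, hI21, hEB1, hUV1⟩ := hAprops δ hδ h1B h1U
  obtain ⟨hM2, hI2, hI22, hEB2, hUV2⟩ := hAprops δ' hδ' h2B h2U
  -- the coupling
  have hdist : LoopConfig.cnLawEDist P (siteLoopConfig δ) P (siteLoopConfig δ') < ENNReal.ofReal ε := by
    have h := hprod (ha δ hδ h1a) (hb δ' hδ' h2b)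
    refine lt_of_le_of_lt h ?_
    exact (ENNReal.ofReal_lt_ofReal_iff hε).2 (by linarith)
  obtain ⟨Q, hQ1, hQ2, hQbad⟩ := LoopConfig.exists_coupling_of_cnLawEDist_lt hdist
  -- the bad sets
  set Sc : ℝ → Set (SiteConfig (Site 2)) := fun d ↦ {ω | ¬ ({u ∈ (siteLoopConfig d ω).loops |
      (u.range ∩ Metric.closedBall (0 : ℂ) (R + 1)).Nonempty ∧ η / 5 ≤ Metric.diam u.range}.Finite ∧
    {u ∈ (siteLoopConfig d ω).loops |
      (u.range ∩ Metric.closedBall (0 : ℂ) (R + 1)).Nonempty ∧ η / 5 ≤ Metric.diam u.range}.ncard ≤ N₀)}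
    with hScdef
  set Sw : ℝ → Set (SiteConfig (Site 2)) := fun d ↦ {ω | ∃ u ∈ (siteLoopConfig d ω).loops,
      (u.range ∩ Metric.closedBall (0 : ℂ) (R + 1)).Nonempty ∧ ¬ (u.range ⊆ Metric.ball (0 : ℂ) D)}
    with hSwdef
  set Ss : ℝ → Set (SiteConfig (Site 2)) := fun d ↦ {ω | ∃ u ∈ (siteLoopConfig d ω).loops,
      (u.range ∩ Metric.closedBall (0 : ℂ) (R + 1)).Nonempty ∧ η / 5 ≤ Metric.diam u.range ∧
      τ < volume.real ({z : ℂ | Metric.infDist z u.range ≤ ε} ∩ Metric.closedBall (0 : ℂ) R)}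
    with hSsdef
  set Sr : ℝ → Set (SiteConfig (Site 2)) := fun d ↦ {ω | ∃ u ∈ (siteLoopConfig d ω).loops,
      ∃ v ∈ (siteLoopConfig d ω).loops,
      u ≠ v ∧ (u.range ∩ Metric.closedBall (0 : ℂ) (R + 1)).Nonempty ∧ η / 5 ≤ Metric.diam u.range ∧
      η / 5 ≤ Metric.diam v.range ∧ u.udist v ≤ 2 * ε} with hSrdef
  have hPc : ∀ d, 0 < d → d < δN → P (Sc d) ≤ ENNReal.ofReal (p₀ / 10) := fun d hd hdN ↦ hN d hd hdN.le
  have hPw : ∀ d, 0 < d → d < δW → P (Sw d) ≤ ENNReal.ofReal (p₀ / 10) := fun d hd hdW ↦ hW d hd hdW.le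
  have hPs : P (Ss δ) ≤ ENNReal.ofReal (p₀ / 10) := hS' δ hδ h1S.le
  have hPr : ∀ d, 0 < d → d < δR → P (Sr d) ≤ ENNReal.ofReal (p₀ / 10) := fun d hd hdR ↦ hR' d hd hdR.le
  set Bad0 : Set (SiteConfig (Site 2) × SiteConfig (Site 2)) :=
    {p | ¬ LoopConfig.IsClose ε (siteLoopConfig δ p.1) (siteLoopConfig δ' p.2)} ∪
      (Prod.fst ⁻¹' (Sc δ ∪ Sw δ ∪ Ss δ ∪ Sr δ) ∪ Prod.snd ⁻¹' (Sc δ' ∪ Sw δ' ∪ Sr δ')) with hBad0def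
  have hBad : Q Bad0 ≤ ENNReal.ofReal (κ₁ ^ 2 / (2 * (4 * B + 1))) := by
    have hp10 : (0 : ℝ) ≤ p₀ / 10 := by positivity
    have e2 : ENNReal.ofReal (p₀ / 10) + ENNReal.ofReal (p₀ / 10) = ENNReal.ofReal (2 * (p₀ / 10)) := by
      rw [← ENNReal.ofReal_add hp10 hp10]; congr 1; ring
    have e3 : ENNReal.ofReal (2 * (p₀ / 10)) + ENNReal.ofReal (p₀ / 10) = ENNReal.ofReal (3 * (p₀ / 10)) := by
      rw [← ENNReal.ofReal_add (by positivity) hp10]; congr 1; ring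
    have e4 : ENNReal.ofReal (3 * (p₀ / 10)) + ENNReal.ofReal (p₀ / 10) = ENNReal.ofReal (4 * (p₀ / 10)) := by
      rw [← ENNReal.ofReal_add (by positivity) hp10]; congr 1; ring
    have hfst : Q (Prod.fst ⁻¹' (Sc δ ∪ Sw δ ∪ Ss δ ∪ Sr δ)) ≤ ENNReal.ofReal (4 * (p₀ / 10)) := by
      refine (Measure.le_map_apply measurable_fst.aemeasurable _).trans ?_
      rw [hQ1]
      have u1 : P (Sc δ ∪ Sw δ ∪ Ss δ ∪ Sr δ) ≤ P (Sc δ ∪ Sw δ ∪ Ss δ) + P (Sr δ) :=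
        measure_union_le (μ := P) (Sc δ ∪ Sw δ ∪ Ss δ) (Sr δ)
      have u2 : P (Sc δ ∪ Sw δ ∪ Ss δ) ≤ P (Sc δ ∪ Sw δ) + P (Ss δ) :=
        measure_union_le (μ := P) (Sc δ ∪ Sw δ) (Ss δ)
      have u3 : P (Sc δ ∪ Sw δ) ≤ P (Sc δ) + P (Sw δ) := measure_union_le (μ := P) (Sc δ) (Sw δ)
      have v1 := hPc δ hδ h1N
      have v2 := hPw δ hδ h1W
      have v4 := hPr δ hδ h1R
      calc P (Sc δ ∪ Sw δ ∪ Ss δ ∪ Sr δ)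
          ≤ ((ENNReal.ofReal (p₀ / 10) + ENNReal.ofReal (p₀ / 10)) + ENNReal.ofReal (p₀ / 10)) +
              ENNReal.ofReal (p₀ / 10) := by
            calc P (Sc δ ∪ Sw δ ∪ Ss δ ∪ Sr δ) ≤ P (Sc δ ∪ Sw δ ∪ Ss δ) + P (Sr δ) := u1
              _ ≤ (P (Sc δ ∪ Sw δ) + P (Ss δ)) + P (Sr δ) := add_le_add u2 le_rfl
              _ ≤ ((P (Sc δ) + P (Sw δ)) + P (Ss δ)) + P (Sr δ) := add_le_add (add_le_add u3 le_rfl) le_rfl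
              _ ≤ _ := add_le_add (add_le_add (add_le_add v1 v2) hPs) v4
        _ = ENNReal.ofReal (4 * (p₀ / 10)) := by rw [e2, e3, e4]
    have hsnd : Q (Prod.snd ⁻¹' (Sc δ' ∪ Sw δ' ∪ Sr δ')) ≤ ENNReal.ofReal (3 * (p₀ / 10)) := by
      refine (Measure.le_map_apply measurable_snd.aemeasurable _).trans ?_
      rw [hQ2]
      have u2 : P (Sc δ' ∪ Sw δ' ∪ Sr δ') ≤ P (Sc δ' ∪ Sw δ') + P (Sr δ') :=
        measure_union_le (μ := P) (Sc δ' ∪ Sw δ') (Sr δ')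
      have u3 : P (Sc δ' ∪ Sw δ') ≤ P (Sc δ') + P (Sw δ') := measure_union_le (μ := P) (Sc δ') (Sw δ')
      have v1 := hPc δ' hδ' h2N
      have v2 := hPw δ' hδ' h2W
      have v4 := hPr δ' hδ' h2R
      calc P (Sc δ' ∪ Sw δ' ∪ Sr δ')
          ≤ (ENNReal.ofReal (p₀ / 10) + ENNReal.ofReal (p₀ / 10)) + ENNReal.ofReal (p₀ / 10) := by
            calc P (Sc δ' ∪ Sw δ' ∪ Sr δ') ≤ P (Sc δ' ∪ Sw δ') + P (Sr δ') := u2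
              _ ≤ (P (Sc δ') + P (Sw δ')) + P (Sr δ') := add_le_add u3 le_rfl
              _ ≤ _ := add_le_add (add_le_add v1 v2) v4
        _ = ENNReal.ofReal (3 * (p₀ / 10)) := by rw [e2, e3]
    have htot : Q Bad0 ≤ ENNReal.ofReal ε + (ENNReal.ofReal (4 * (p₀ / 10)) + ENNReal.ofReal (3 * (p₀ / 10))) :=
      (measure_union_le _ _).trans (add_le_add hQbad.le ((measure_union_le _ _).trans (add_le_add hfst hsnd)))
    have e5 : ENNReal.ofReal ε + (ENNReal.ofReal (4 * (p₀ / 10)) + ENNReal.ofReal (3 * (p₀ / 10))) =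
        ENNReal.ofReal (ε + (4 * (p₀ / 10) + 3 * (p₀ / 10))) := by
      rw [← ENNReal.ofReal_add (by positivity) (by positivity), ← ENNReal.ofReal_add hε.le (by positivity)]
    rw [e5] at htot
    refine htot.trans (ENNReal.ofReal_le_ofReal ?_)
    rw [← hp₀def]; linarith
  -- on the good set the comparison applies
  have hgood : ∀ p, p ∉ Bad0 → |Abar δ p.1 - Abar δ' p.2| ≤ κ₁ := by
    intro p hp
    have hu : ∀ {α : Type} {s t : Set α} {x : α}, x ∉ s ∪ t → x ∉ s ∧ x ∉ t :=
      fun h ↦ ⟨fun hs ↦ h (Or.inl hs), fun ht ↦ h (Or.inr ht)⟩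
    rw [hBad0def] at hp
    obtain ⟨hclose, hrest⟩ := hu hp
    obtain ⟨hp1, hp2⟩ := hu hrest
    have hp1' : p.1 ∉ Sc δ ∪ Sw δ ∪ Ss δ ∪ Sr δ := hp1
    have hp2' : p.2 ∉ Sc δ' ∪ Sw δ' ∪ Sr δ' := hp2
    obtain ⟨h123, hr1⟩ := hu hp1'
    obtain ⟨h12, hs1⟩ := hu h123
    obtain ⟨hc1, hw1⟩ := hu h12
    obtain ⟨h12', hr2⟩ := hu hp2'
    obtain ⟨hc2, hw2⟩ := hu h12'
    have hclose' : LoopConfig.IsClose ε (siteLoopConfig δ p.1) (siteLoopConfig δ' p.2) := not_not.1 hclose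
    simp only [hScdef, Set.mem_setOf_eq, not_not] at hc1 hc2
    simp only [hSwdef, Set.mem_setOf_eq, not_exists, not_and, not_not] at hw1 hw2
    simp only [hSsdef, Set.mem_setOf_eq, not_exists, not_and, not_lt] at hs1
    simp only [hSrdef, Set.mem_setOf_eq, not_exists, not_and, not_le] at hr1 hr2
    have hballD : Metric.ball (0 : ℂ) D ⊆ Metric.ball 0 (1 / ε) := by
      refine Metric.ball_subset_ball ?_
      have := hεD
      rwa [le_one_div hε hD] at this
    have key := hCmp f R C hf hC hR h0 (siteLoopConfig δ p.1) (siteLoopConfig δ' p.2) ε η τ m N₀ hε hε1 hη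
      h8m hτ.le hclose' hc1 hc2
      (fun u hu hmeet _ ↦ (hw1 u hu hmeet).trans hballD)
      (fun u hu hmeet _ ↦ (hw2 u hu hmeet).trans hballD)
      (fun u hu v hv hmu _ hdu hdv huv ↦ hr1 u hu v hv huv hmu hdu hdv)
      (fun u hu v hv hmu _ hdu hdv huv ↦ hr2 u hu v hv huv hmu hdu hdv)
      (fun u hu hmeet hdu ↦ hs1 u hu hmeet hdu)
    exact key.trans hcmpBound
  -- the coupling estimate
  have hmid := el_coupling_estimate (P := P) (Q := Q) hM1 hM2 hI1 hI2 hI21 hI22 hEB1 hEB2 hB.le hκ₁ hQ1 hQ2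
    hBad hgood
  -- conclusion
  have htri : |truncNestingTransform P (siteLoopConfig δ) f 0 - truncNestingTransform P (siteLoopConfig δ') f 0|
      ≤ |truncNestingTransform P (siteLoopConfig δ) f 0 - ∫ ω, Abar δ ω ∂P| +
        |∫ ω, Abar δ ω ∂P - ∫ ω, Abar δ' ω ∂P| +
        |∫ ω, Abar δ' ω ∂P - truncNestingTransform P (siteLoopConfig δ') f 0| := by
    have key : truncNestingTransform P (siteLoopConfig δ) f 0 - truncNestingTransform P (siteLoopConfig δ') f 0 =
        (truncNestingTransform P (siteLoopConfig δ) f 0 - ∫ ω, Abar δ ω ∂P) +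
        (∫ ω, Abar δ ω ∂P - ∫ ω, Abar δ' ω ∂P) +
        (∫ ω, Abar δ' ω ∂P - truncNestingTransform P (siteLoopConfig δ') f 0) := by ring
    rw [key]
    exact abs_add_three _ _ _
  rw [abs_sub_comm] at hUV2
  calc |truncNestingTransform P (siteLoopConfig δ) f 0 - truncNestingTransform P (siteLoopConfig δ') f 0|
      ≤ κ₁ + 2 * κ₁ + κ₁ := htri.trans (add_le_add (add_le_add hUV1 hmid) hUV2)
    _ ≤ κ := by rw [hκ₁def]; linarith

end Summit.CriticalPhenomena.CardyFormulaZ2.Cruxes.MagicFormulaT.LineSketch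

end
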